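import Summits.KontsevichZagierPeriods.KontsevichZagierPeriods.Theorems.LinRedNormalFormHoffmanSpanInKZModCert

/-!
# Crux `LinRedNormalForm.HoffmanSpanInKZ` (stmt-KontsevichZagierPeriods-15044), line `Sketch`:
# FAST mod-`p` transcript checking — accumulation on word codes with natural arithmetic (registered stub `stub_fastAcc`)

The mod-`p` checkers of `LinRedNormalFormHoffmanSpanInKZModTables` key the accumulator by words as
`List Bool` (compared letter by letter) and compute in `ZMod p` (every operation unfolding the ring structure of
`ZMod`); measured on the farm, the kernel spends `≈ 7 ms` per merge step, i.e. `≈ 1600 s` for the weight-`11` table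
and `≈ 9000 s` at weight `12`.  This file runs the SAME transcript check on natural numbers only: words are kept
as their codes (compared with `Nat.blt` / `Nat.beq`, kernel-accelerated) and coefficients as naturals `< p` with
explicit `% p` (`Nat.add` / `Nat.mul` / `Nat.mod`, kernel-accelerated).  The realisation `evalC` reads a code back
through `wordOfCode`, so combining equal codes is sound with no encoding lemma; the generator's words are encoded by
`codeOfWord` and the round trip is CHECKED per term (`codeOk`, decided), not proved.  This file: codes, the
realisation `evalC`, insertion / merging / forced folds with their realisation lemmas, and the checked encoding of
a generator (`Gen.fvecC`, `codeOk`, `evalC_fvecC`); the row and table checkers with their soundness and the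
assembly are `LinRedNormalFormHoffmanSpanInKZFastCert`.

Sources: the reflection set-up of the Derived / ModTables files (this tree). [folklore]
-/

namespace Summit.KontsevichZagierPeriods.LinRedNormalForm.HoffmanSpanInKZ

open Literature.NumberTheory.Transcendental
open Summit.KontsevichZagierPeriods.MzvKernelInKZ.Negative
open Summit.KontsevichZagierPeriods.MzvKernelInKZ.TwoPosets
open Submodule

/-! ## Codes, and combinations of codes with natural coefficients -/

/-- The code `Σ εᵢ 2^(N-1-i)` of a word-as-list (inverse of `wordOfCode` on words of length `N`; the round trip is
checked per use, `codeOk`). [folklore] -/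
def codeOfWord (w : List Bool) : ℕ := w.foldl (fun c b => 2 * c + cond b 1 0) 0

/-- Realisation of a combination of word codes with natural coefficients, modulo `p`. [folklore] -/
def evalC (p N : ℕ) (v : List (ℕ × ℕ)) : (Fin N → Bool) → ZMod p :=
  (v.map fun q => ((q.2 : ℕ) : ZMod p) • (Pi.single (wordOf N (wordOfCode N q.1)) (1 : ZMod p) :
    (Fin N → Bool) → ZMod p)).sum

section EvalC

variable {p N : ℕ}

/-- Realisation of the empty combination. [folklore] -/
@[simp] theorem evalC_nil : evalC p N [] = 0 := by simp [evalC]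

/-- Realisation of a combination with a leading term. [folklore] -/
@[simp] theorem evalC_cons (q : ℕ × ℕ) (v : List (ℕ × ℕ)) :
    evalC p N (q :: v) = ((q.2 : ℕ) : ZMod p) • (Pi.single (wordOf N (wordOfCode N q.1)) (1 : ZMod p) :
      (Fin N → Bool) → ZMod p) + evalC p N v := by
  simp [evalC]

/-- Realisation is additive under concatenation. [folklore] -/
@[simp] theorem evalC_append (u v : List (ℕ × ℕ)) : evalC p N (u ++ v) = evalC p N u + evalC p N v := by
  simp [evalC, List.sum_append]

/-- A reduced sum casts to the sum. [folklore] -/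
theorem cast_add_mod (a b : ℕ) : (((a + b) % p : ℕ) : ZMod p) = (a : ZMod p) + (b : ZMod p) := by
  rw [ZMod.natCast_mod, Nat.cast_add]

/-- A reduced product casts to the product. [folklore] -/
theorem cast_mul_mod (a b : ℕ) : (((a * b) % p : ℕ) : ZMod p) = (a : ZMod p) * (b : ZMod p) := by
  rw [ZMod.natCast_mod, Nat.cast_mul]

/-- The reduced complement casts to the negation (for `0 < p`). [folklore] -/
theorem cast_neg_mod (hp : 0 < p) (a : ℕ) : (((p - a % p) % p : ℕ) : ZMod p) = -(a : ZMod p) := by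
  rw [ZMod.natCast_mod, eq_neg_iff_add_eq_zero, ← ZMod.natCast_mod a p, ← Nat.cast_add,
    Nat.sub_add_cancel (Nat.mod_lt a hp).le, ZMod.natCast_self]

end EvalC

/-! ## Sorted sparse accumulation on codes -/

section Acc

variable (p : ℕ)

/-- Insert-add one term `(c, x)` into an association list sorted by code (equal codes combined mod `p`, a zero
dropped). [folklore] -/
def insC (c x : ℕ) : List (ℕ × ℕ) → List (ℕ × ℕ)
  | [] => [(c, x)]
  | (c', x') :: l =>
    bif c == c' then (bif (x + x') % p == 0 then l else (c', (x + x') % p) :: l)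
    else bif Nat.blt c c' then (c, x) :: (c', x') :: l
    else (c', x') :: insC c x l

/-- Inner recursion of `mergeC`. [folklore] -/
def mergeCAux (q : ℕ × ℕ) (contV : List (ℕ × ℕ) → List (ℕ × ℕ)) : List (ℕ × ℕ) → List (ℕ × ℕ)
  | [] => q :: contV []
  | (c', x') :: acc =>
    bif q.1 == c' then (bif (q.2 + x') % p == 0 then contV acc else (c', (q.2 + x') % p) :: contV acc)
    else bif Nat.blt q.1 c' then q :: contV ((c', x') :: acc)
    else (c', x') :: mergeCAux q contV acc

/-- Merge `x • v` into `acc` (codes increasing in both; coefficients mod `p`). [folklore] -/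
def mergeC (x : ℕ) : List (ℕ × ℕ) → List (ℕ × ℕ) → List (ℕ × ℕ)
  | [] => fun acc => acc
  | (c, y) :: v => mergeCAux p (c, (x * y) % p) (mergeC x v)

/-- Insert a list of terms, forcing the accumulator after each insertion. [folklore] -/
def foldInsC : List (ℕ × ℕ) → List (ℕ × ℕ) → List (ℕ × ℕ)
  | [], acc => acc
  | q :: g, acc =>
    bif (insC p q.1 q.2 acc).length == (insC p q.1 q.2 acc).length then foldInsC g (insC p q.1 q.2 acc)
    else foldInsC g (insC p q.1 q.2 acc)

/-- Merge the cited vectors (fetched by index through `get`, coefficient negated if `neg`), forcing the accumulator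
after each merge. [folklore] -/
def foldMergeC (get : ℕ → List (ℕ × ℕ)) (neg : Bool) : List (ℕ × ℕ) → List (ℕ × ℕ) → List (ℕ × ℕ)
  | [], acc => acc
  | q :: L, acc =>
    bif (mergeC p (bif neg then (p - q.2 % p) % p else q.2 % p) (get q.1) acc).length ==
        (mergeC p (bif neg then (p - q.2 % p) % p else q.2 % p) (get q.1) acc).length then
      foldMergeC get neg L (mergeC p (bif neg then (p - q.2 % p) % p else q.2 % p) (get q.1) acc)
    else foldMergeC get neg L (mergeC p (bif neg then (p - q.2 % p) % p else q.2 % p) (get q.1) acc)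

variable {p} {N : ℕ}

/-- `insC` adds one term to the realisation. [folklore] -/
theorem evalC_insC (c x : ℕ) : ∀ l,
    evalC p N (insC p c x l) = ((x : ℕ) : ZMod p) • (Pi.single (wordOf N (wordOfCode N c)) (1 : ZMod p) :
      (Fin N → Bool) → ZMod p) + evalC p N l
  | [] => by simp [insC]
  | (c', x') :: l => by
    unfold insC
    cases hcc : (c == c') <;> simp only [cond_true, cond_false]
    · cases hlt : Nat.blt c c' <;> simp only [cond_true, cond_false]
      · rw [evalC_cons, evalC_cons, evalC_insC c x l]
        abel
      · rw [evalC_cons]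
    · have hc : c = c' := by simpa using hcc
      subst hc
      cases hz : ((x + x') % p == 0) <;> simp only [cond_true, cond_false]
      · rw [evalC_cons, evalC_cons, cast_add_mod, add_smul, add_assoc]
      · have h0 : ((x : ℕ) : ZMod p) + ((x' : ℕ) : ZMod p) = 0 := by
          rw [← cast_add_mod, show (x + x') % p = 0 by simpa using hz, Nat.cast_zero]
        rw [evalC_cons, ← add_assoc, ← add_smul, h0, zero_smul, zero_add]

/-- `mergeCAux` realises to the term plus the continuation's contribution. [folklore] -/
theorem evalC_mergeCAux (q : ℕ × ℕ) (contV : List (ℕ × ℕ) → List (ℕ × ℕ)) (e : (Fin N → Bool) → ZMod p)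
    (hcont : ∀ acc, evalC p N (contV acc) = e + evalC p N acc) :
    ∀ acc, evalC p N (mergeCAux p q contV acc) =
      ((q.2 : ℕ) : ZMod p) • (Pi.single (wordOf N (wordOfCode N q.1)) (1 : ZMod p) : (Fin N → Bool) → ZMod p) +
        e + evalC p N acc
  | [] => by simp only [mergeCAux, evalC_cons, hcont, evalC_nil]; abel
  | (c', x') :: acc => by
    unfold mergeCAux
    cases hcc : (q.1 == c') <;> simp only [cond_true, cond_false]
    · cases hlt : Nat.blt q.1 c' <;> simp only [cond_true, cond_false]
      · rw [evalC_cons, evalC_cons, evalC_mergeCAux q contV e hcont acc]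
        abel
      · rw [evalC_cons, hcont, evalC_cons]
        abel
    · have hc : q.1 = c' := by simpa using hcc
      cases hz : ((q.2 + x') % p == 0) <;> simp only [cond_true, cond_false]
      · rw [evalC_cons, hcont, evalC_cons, ← hc, cast_add_mod, add_smul]
        abel
      · have h0 : ((q.2 : ℕ) : ZMod p) + ((x' : ℕ) : ZMod p) = 0 := by
          rw [← cast_add_mod, show (q.2 + x') % p = 0 by simpa using hz, Nat.cast_zero]
        rw [hcont, evalC_cons, ← hc]
        have : ((q.2 : ℕ) : ZMod p) • (Pi.single (wordOf N (wordOfCode N q.1)) (1 : ZMod p) :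
            (Fin N → Bool) → ZMod p) + ((x' : ℕ) : ZMod p) • (Pi.single (wordOf N (wordOfCode N q.1))
              (1 : ZMod p) : (Fin N → Bool) → ZMod p) = 0 := by
          rw [← add_smul, h0, zero_smul]
        rw [show ((q.2 : ℕ) : ZMod p) • (Pi.single (wordOf N (wordOfCode N q.1)) (1 : ZMod p) :
              (Fin N → Bool) → ZMod p) + e + (((x' : ℕ) : ZMod p) • (Pi.single (wordOf N (wordOfCode N q.1))
                (1 : ZMod p) : (Fin N → Bool) → ZMod p) + evalC p N acc) =
            (((q.2 : ℕ) : ZMod p) • (Pi.single (wordOf N (wordOfCode N q.1)) (1 : ZMod p) :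
              (Fin N → Bool) → ZMod p) + ((x' : ℕ) : ZMod p) • (Pi.single (wordOf N (wordOfCode N q.1))
                (1 : ZMod p) : (Fin N → Bool) → ZMod p)) + (e + evalC p N acc) by abel, this, zero_add]

/-- `mergeC x v acc` realises to `x • v + acc`. [folklore] -/
theorem evalC_mergeC (x : ℕ) : ∀ v acc,
    evalC p N (mergeC p x v acc) = ((x : ℕ) : ZMod p) • evalC p N v + evalC p N acc
  | [], acc => by simp [mergeC]
  | (c, y) :: v, acc => by
    rw [mergeC, evalC_mergeCAux (c, (x * y) % p) (mergeC p x v) (((x : ℕ) : ZMod p) • evalC p N v)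
      (evalC_mergeC x v) acc, evalC_cons, smul_add]
    simp only [cast_mul_mod, mul_smul, add_assoc]

/-- `foldInsC` realises as inserting all terms. [folklore] -/
theorem evalC_foldInsC : ∀ (g acc : List (ℕ × ℕ)), evalC p N (foldInsC p g acc) = evalC p N g + evalC p N acc
  | [], acc => by simp [foldInsC]
  | q :: g, acc => by
    rw [foldInsC, Bool.cond_self, evalC_foldInsC g, evalC_insC, evalC_cons]
    abel

/-- The coefficient of a citation, as a natural `< p`, possibly negated. [folklore] -/
def citeC (p : ℕ) (neg : Bool) (x : ℕ) : ℕ := bif neg then (p - x % p) % p else x % p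

/-- The cast of `citeC` (for `0 < p`). [folklore] -/
theorem cast_citeC (hp : 0 < p) (neg : Bool) (x : ℕ) :
    ((citeC p neg x : ℕ) : ZMod p) = (bif neg then -((x : ℕ) : ZMod p) else ((x : ℕ) : ZMod p)) := by
  cases neg
  · simp [citeC, ZMod.natCast_mod]
  · simp only [citeC, cond_true]
    exact cast_neg_mod hp x

/-- `foldMergeC` realises as merging all citations. [folklore] -/
theorem evalC_foldMergeC (get : ℕ → List (ℕ × ℕ)) (neg : Bool) : ∀ (L : List (ℕ × ℕ)) (acc : List (ℕ × ℕ)),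
    evalC p N (foldMergeC p get neg L acc) =
      (L.map fun q => ((citeC p neg q.2 : ℕ) : ZMod p) • evalC p N (get q.1)).sum + evalC p N acc
  | [], acc => by simp [foldMergeC]
  | q :: L, acc => by
    rw [foldMergeC, Bool.cond_self, evalC_foldMergeC get neg L, ← citeC, evalC_mergeC, List.map_cons,
      List.sum_cons]
    abel

end Acc

/-! ## Encoding the generator, checked -/

/-- The generator's integer expansion with words encoded and coefficients reduced to naturals `< p`. [folklore] -/
def Gen.fvecC (p N : ℕ) (g : Gen) : List (ℕ × ℕ) :=
  (g.fvecZ N).map fun q => (codeOfWord q.1, (q.2 % (p : ℤ)).toNat)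

/-- Boolean test: every word of the generator's expansion survives the encoding round trip, read in length `N`
(as functions). [folklore] -/
def codeOk (N : ℕ) (g : Gen) : Bool :=
  (g.fvecZ N).all fun q => decide (wordOf N (wordOfCode N (codeOfWord q.1)) = wordOf N q.1)

/-- The cast of a reduced integer. [folklore] -/
theorem cast_toNat_emod (p : ℕ) (hp : 0 < p) (z : ℤ) : ((((z % (p : ℤ)).toNat : ℕ) : ℤ) : ZMod p) = (z : ZMod p) := by
  rw [Int.toNat_of_nonneg (Int.emod_nonneg _ (by exact_mod_cast hp.ne')), ZMod.intCast_mod]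

/-- With the round trip checked, the encoded expansion realises as the mod-`p` expansion. [folklore] -/
theorem evalC_fvecC {p N : ℕ} (hp : 0 < p) (g : Gen) (h : codeOk N g = true) :
    evalC p N (g.fvecC p N) = evalG (ZMod p) N (g.fvecP p N) := by
  unfold Gen.fvecC Gen.fvecP
  have key : ∀ l : List (List Bool × ℤ), (l.all fun q => decide (wordOf N (wordOfCode N (codeOfWord q.1)) =
      wordOf N q.1)) = true →
      evalC p N (l.map fun q => (codeOfWord q.1, (q.2 % (p : ℤ)).toNat)) =
        evalG (ZMod p) N (l.map fun q => (q.1, (q.2 : ZMod p))) := by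
    intro l
    induction l with
    | nil => intro; simp
    | cons q l ih =>
      intro hall
      simp only [List.all_cons, Bool.and_eq_true, decide_eq_true_eq] at hall
      rw [List.map_cons, List.map_cons, evalC_cons, evalG_cons, ih hall.2, hall.1]
      congr 2
      have := cast_toNat_emod p hp q.2
      rw [Int.cast_natCast] at this
      exact this
  exact key _ h

/-! ## The registered stub -/

/-- The realisation facts of this file used by the fast checkers, as one statement (vocabulary file; not a
published fact). -/
def FastAccSound : Prop :=
  (∀ (p N : ℕ) (get : ℕ → List (ℕ × ℕ)) (neg : Bool) (L acc : List (ℕ × ℕ)),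
      evalC p N (foldMergeC p get neg L acc) =
        (L.map fun q => ((citeC p neg q.2 : ℕ) : ZMod p) • evalC p N (get q.1)).sum + evalC p N acc) ∧
  (∀ (p N : ℕ), 0 < p → ∀ g : Gen, codeOk N g = true → evalC p N (g.fvecC p N) = evalG (ZMod p) N (g.fvecP p N))

/-- **Registered stub `stub_fastAcc`** of the skeleton of line `Sketch`. -/
theorem stub_fastAcc : FastAccSound := ⟨fun _ _ get neg L acc => evalC_foldMergeC get neg L acc,
  fun _ _ hp g h => evalC_fvecC hp g h⟩

end Summit.KontsevichZagierPeriods.LinRedNormalForm.HoffmanSpanInKZ
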